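import Summits.MatrixMultiplication.MatrixMultiplication.Theses.FarEdgeDescent
import Literature.Computability.AlgebraicComplexity.LaserMethodBigCW
import Literature.Computability.AlgebraicComplexity.MaxEntropyGivenMarginals
import Literature.Computability.AlgebraicComplexity.LaserMethodTypeCount
import Literature.Computability.AlgebraicComplexity.CoppersmithWinograd1990Proofs
import Literature.Computability.AlgebraicComplexity.RectangularExponentLaserCertificate
import Literature.Computability.AlgebraicComplexity.RectangularExponentAsymptoticRank
import Literature.Computability.AlgebraicComplexity.RectangularExponentSymmetry
import Literature.Computability.AlgebraicComplexity.SchonhageRectangular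
import HarnessLib
import Summits.MatrixMultiplication.MatrixMultiplication.Theorems.ShapeSubmodularityPerfectAmortisationStubCwRectRestriction

/-!
# Route `FarEdgeDescent` — aside `LogRate` (stmt-MatrixMultiplication-25370): layers B1′ and C′

File 1/2 of the landing of the lens-2 kernel `FarEdgeDescentLogRate.lean` (decomp-mm gen 4 rev f; sha256
07919df6…eefd, 716 lines, rc 0 · 0 sorry · std axioms, critic-endorsed), split for the gate rule «Theorems files
with proofs ≤ 400 lines»; statements and proofs unchanged.  This file: layer B1′ (`cwFullDiagonalRaw`, a large
free diagonal of the full 6-letter joint type `(m, m, k·m; s, s, r)` of `CW_q`) and layer C′ (`cwFullThreshold`,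
the analytic threshold for the scaled type `L·Q`, `L → ∞`).  Layer A of the draft (a verbatim copy of the
tree's `PerfectAmortisation.stub_cwRectRestriction`) is NOT restated: the landed module
`Theorems/ShapeSubmodularityPerfectAmortisationStubCwRectRestriction.lean` is imported instead (gate rule
`dedup.landed`).  Layers B2′, D′, the `s = r = 0` slice and the closer `logRate` are in
`Theorems/FarEdgeDescentLogRate.lean` (file 2/2).
-/

set_option linter.dupNamespace false

noncomputable section

open Finset
open scoped BigOperators

namespace Summit.MatrixMultiplication.MatrixMultiplication.Theorems.FarEdgeDescentLogRate

open Literature.Computability.AlgebraicComplexity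
open Literature.Barriers.MatrixMultiplication (bigCwTensor)

/-! ## Layer B1′ — a large free diagonal of the full 6-letter joint type -/

/-- **B1′.** For `k, m ≥ 1`, `N = (k+2) m + 2 s + r` and `P = Q/N` with `Q(1,1,0) = Q(0,1,1) = m`,
`Q(1,0,1) = k m`, `Q(2,0,0) = Q(0,0,2) = s`, `Q(0,2,0) = r` (`0` elsewhere), there is a family `Δ` of
triples of level words, coordinatewise in `cwSupport₃`, each with exactly `m`, `m`, `k m` positions of
pattern `(1,1,0)`, `(0,1,1)`, `(1,0,1)`, forming a free diagonal, with
`2^{N (min_m H(P_m) − Γ_S(P))} ≤ |Δ| · (N+1)^63 · 192 · exp(4 √(log 6 + N log 27))`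
(`exists_free_diagonal_jointType_card` for `S = cwSupport₃`, `b = 2`, `G = 27`, `A = 9`).
[cite: LeGall2014, Appendix A.3, Eq. (7) and p. 24] -/
theorem cwFullDiagonalRaw :
    ∀ m k s r N : ℕ, 1 ≤ m → 1 ≤ k → (k + 2) * m + 2 * s + r = N →
      ∀ P : Fin 3 × Fin 3 × Fin 3 → ℝ,
      (∀ x, P x = ((if x = (1, 1, 0) then m else if x = (0, 1, 1) then m
          else if x = (1, 0, 1) then k * m else if x = (2, 0, 0) then s
          else if x = (0, 0, 2) then s else if x = (0, 2, 0) then r else 0 : ℕ) : ℝ) / (N : ℝ)) →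
      ∃ Δ : Finset ((Fin N → Fin 3) × (Fin N → Fin 3) × (Fin N → Fin 3)),
        (∀ δ ∈ Δ, ∀ ρ, labelSeq δ ρ ∈ cwSupport₃) ∧
        (∀ δ ∈ Δ, letterCount (labelSeq δ) (1, 1, 0) = m ∧ letterCount (labelSeq δ) (0, 1, 1) = m ∧
          letterCount (labelSeq δ) (1, 0, 1) = k * m) ∧
        (∀ δ ∈ Δ, ∀ δ' ∈ Δ, ∀ δ'' ∈ Δ, (∀ ρ, (δ.1 ρ, δ'.2.1 ρ, δ''.2.2 ρ) ∈ cwSupport₃) →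
          δ = δ' ∧ δ' = δ'') ∧
        (2 : ℝ) ^ ((N : ℝ) *
            (min (shannonEntropy (marginalDist₁ P))
              (min (shannonEntropy (marginalDist₂ P)) (shannonEntropy (marginalDist₃ P))) -
              maxEntropyPenalty cwSupport₃ P)) ≤
          (Δ.card : ℝ) * ((N : ℝ) + 1) ^ 63 * 192 *
            Real.exp (4 * Real.sqrt (Real.log 6 + (N : ℝ) * Real.log 27)) := by
  intro m k s r N hm hk hNdef P hP
  classical
  -- tightness data of `cwSupport₃` (as in `bigCw_laser_inequality`)
  have hinj : Function.Injective fun (i : Fin 3) (_ : Fin 1) => (i : ℤ) := by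
    intro i i' h
    have h0 := congrFun h 0
    simp only [Nat.cast_inj] at h0
    exact Fin.ext h0
  have hinjγ : Function.Injective fun (l : Fin 3) (_ : Fin 1) => (l : ℤ) - 2 := by
    intro l l' h
    have h0 := congrFun h 0
    simp only [sub_left_inj, Nat.cast_inj] at h0
    exact Fin.ext h0
  have hbd : ∀ (i : Fin 3) (ρ : Fin 1), |((fun (i : Fin 3) (_ : Fin 1) => (i : ℤ)) i ρ)| ≤ (2 : ℕ) := by
    intro i ρ
    have := i.isLt
    simp only [Nat.cast_ofNat, Nat.abs_cast]
    omega
  have htight : ∀ x ∈ cwSupport₃, ∀ ρ : Fin 1,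
      (fun (i : Fin 3) (_ : Fin 1) => (i : ℤ)) x.1 ρ + (fun (j : Fin 3) (_ : Fin 1) => (j : ℤ)) x.2.1 ρ +
        (fun (l : Fin 3) (_ : Fin 1) => (l : ℤ) - 2) x.2.2 ρ = 0 := by
    intro x hx ρ
    rw [mem_cwSupport₃] at hx
    simp only
    omega
  -- the joint type `Q` and `N = (k+2) m + 2 s + r`
  obtain ⟨Q, hQdef⟩ : ∃ Q : Fin 3 × Fin 3 × Fin 3 → ℕ, Q = fun x =>
      if x = (1, 1, 0) then m else if x = (0, 1, 1) then m else if x = (1, 0, 1) then k * m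
      else if x = (2, 0, 0) then s else if x = (0, 0, 2) then s else if x = (0, 2, 0) then r else 0 :=
    ⟨_, rfl⟩
  have hN : 0 < N := by
    rw [← hNdef]; have := Nat.mul_pos (show 0 < k + 2 by omega) (show 0 < m by omega); omega
  have hQS : ∀ x, x ∉ cwSupport₃ → Q x = 0 := by
    intro x hx
    rw [mem_cwSupport₃_iff] at hx
    push Not at hx
    obtain ⟨h1, h2, h3, h4, h5, h6⟩ := hx
    simp [hQdef, h1, h2, h3, h4, h5, h6]
  have hQ : ∑ x, Q x = N := by
    rw [sum_triple_eq, hQdef, ← hNdef]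
    simp [Fin.sum_univ_three]
    ring
  have hP' : ∀ x, P x = (Q x : ℝ) / (N : ℝ) := by
    intro x
    rw [hQdef]
    exact hP x
  -- the tree theorem
  obtain ⟨Δ, hΔQ, hfree, hsize⟩ := exists_free_diagonal_jointType_card cwSupport₃ (r := 1) (b := 2)
    (fun (i : Fin 3) (_ : Fin 1) => (i : ℤ)) (fun (j : Fin 3) (_ : Fin 1) => (j : ℤ))
    (fun (l : Fin 3) (_ : Fin 1) => (l : ℤ) - 2) hinj hinj hinjγ hbd hbd htight hN Q hQS hQ P hP'
  have hQδ : ∀ δ ∈ Δ, letterCount (labelSeq δ) = Q := fun δ hδ => (Finset.mem_filter.1 (hΔQ hδ)).2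
  refine ⟨Δ, ?_, ?_, hfree, ?_⟩
  · -- coordinatewise support
    intro δ hδ ρ
    by_contra hρ
    have h0 := hQS _ hρ
    rw [← hQδ δ hδ] at h0
    exact (letterCount_pos_of_apply (labelSeq δ) ρ).ne' h0
  · -- the three letter counts
    intro δ hδ
    rw [hQδ δ hδ, hQdef]
    simp
  · -- the size bound, constants evaluated
    refine hsize.trans_eq ?_
    have hmax : (max 2 1 : ℕ) = 2 := by decide
    generalize (N : ℝ) = Nr
    simp only [Fintype.card_prod, Fintype.card_fin, hmax]
    norm_num
    simp only [mul_assoc]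


/-! ## Layer C′ — analytic threshold for the scaled type `L·Q`, `L → ∞` -/

/-- The subexponential loss of the laser method, `(N+1)^63 · 192 · exp(4 √(log 6 + N log 27))`
with `N = (K+2)·M`, is at most `exp(κ·M)` as soon as
`(126 √(K+3) + 4 √(log 6 + (K+2) log 27)) · √M + log 192 ≤ κ·M` (and `K ≥ 0`, `M ≥ 1`):
take logarithms and use `log x ≤ 2 √x`, `N + 1 ≤ (K+3)·M`,
`log 6 + N log 27 ≤ (log 6 + (K+2) log 27)·M`. [folklore] -/
private theorem loss_le_exp {K M κ : ℝ} (hK : 0 ≤ K) (hM : 1 ≤ M)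
    (hbound : (126 * √(K + 3) + 4 * √(Real.log 6 + (K + 2) * Real.log 27)) * √M +
      Real.log 192 ≤ κ * M) :
    ((K + 2) * M + 1) ^ 63 * 192 * Real.exp (4 * √(Real.log 6 + (K + 2) * M * Real.log 27)) ≤
      Real.exp (κ * M) := by
  have h6 : 0 ≤ Real.log 6 := Real.log_nonneg (by norm_num)
  have h27 : 0 ≤ Real.log 27 := Real.log_nonneg (by norm_num)
  have hX : 0 ≤ Real.log 6 + (K + 2) * Real.log 27 := add_nonneg h6 (by positivity)
  have hM0 : 0 ≤ M := zero_le_one.trans hM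
  have hN0 : 0 < (K + 2) * M + 1 := by positivity
  -- `log (N+1) ≤ 2 √(N+1) ≤ 2 √(K+3) √M`
  have hN1 : (K + 2) * M + 1 ≤ (K + 3) * M := by nlinarith
  have hlog : Real.log ((K + 2) * M + 1) ≤ 2 * √((K + 2) * M + 1) := log_le_two_mul_sqrt hN0
  have hs1 : √((K + 2) * M + 1) ≤ √(K + 3) * √M := by
    rw [← Real.sqrt_mul (by positivity)]
    exact Real.sqrt_le_sqrt hN1
  -- `√(log 6 + N log 27) ≤ √(log 6 + (K+2) log 27) · √M`
  have hin : Real.log 6 + (K + 2) * M * Real.log 27 ≤ (Real.log 6 + (K + 2) * Real.log 27) * M := by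
    nlinarith
  have hs2 : √(Real.log 6 + (K + 2) * M * Real.log 27) ≤
      √(Real.log 6 + (K + 2) * Real.log 27) * √M := by
    rw [← Real.sqrt_mul hX]
    exact Real.sqrt_le_sqrt hin
  -- take logarithms
  rw [← Real.log_le_iff_le_exp (by positivity), Real.log_mul (by positivity) (by positivity),
    Real.log_mul (by positivity) (by positivity), Real.log_pow, Real.log_exp]
  push_cast
  linarith [hlog, hs1, hs2, hbound]

/-- **C′ (analytic threshold).** For `q ≥ 2`, `m ≥ 1`, `N₀ ≥ 2`, any real `H` and `δ > 0` there is
`L ≥ 1` such that, with `N = L·N₀`, every `V : ℕ` with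
`exp(N·H) ≤ V · (N+1)^63 · 192 · exp(4 √(log 6 + N log 27))` satisfies
`(q+2)^N ≤ V · (q^{L m})^((log(q+2) − H)/((m/N₀) log q) + δ)`
(`(q^{Lm})^{E+δ} = (q+2)^N · exp(δ L m log q − N H)`; `loss_le_exp` with `K = N₀ − 2`, `M = L`,
`κ = δ m log q`). [folklore] -/
theorem cwFullThreshold :
    ∀ q m N₀ : ℕ, 2 ≤ q → 1 ≤ m → 2 ≤ N₀ → ∀ H δ : ℝ, 0 < δ → ∃ L : ℕ, 1 ≤ L ∧ ∀ V : ℕ,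
      Real.exp (((L * N₀ : ℕ) : ℝ) * H) ≤
          (V : ℝ) * (((L * N₀ : ℕ) : ℝ) + 1) ^ 63 * 192 *
            Real.exp (4 * Real.sqrt (Real.log 6 + ((L * N₀ : ℕ) : ℝ) * Real.log 27)) →
      ((q : ℝ) + 2) ^ (L * N₀) ≤ (V : ℝ) * ((q ^ (L * m) : ℕ) : ℝ) ^
          ((Real.log ((q : ℝ) + 2) - H) / ((m : ℝ) / (N₀ : ℝ) * Real.log (q : ℝ)) + δ) := by
  intro q m N₀ hq hm hN₀ H δ hδ
  have hq1 : (1 : ℝ) < q := by exact_mod_cast (lt_of_lt_of_le one_lt_two hq)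
  have hq0 : (0 : ℝ) < q := zero_lt_one.trans hq1
  have hL : 0 < Real.log (q : ℝ) := Real.log_pos hq1
  have hm1 : (1 : ℝ) ≤ m := by exact_mod_cast hm
  have hm0 : (0 : ℝ) < m := by linarith
  have hN₀2 : (2 : ℝ) ≤ N₀ := by exact_mod_cast hN₀
  have hN₀0 : (0 : ℝ) < N₀ := by linarith
  have hK : (0 : ℝ) ≤ (N₀ : ℝ) - 2 := by linarith
  -- the threshold
  obtain ⟨L₀, hL₀⟩ := exists_nat_forall_sqrt_le
    (126 * √((N₀ : ℝ) - 2 + 3) + 4 * √(Real.log 6 + ((N₀ : ℝ) - 2 + 2) * Real.log 27)) (Real.log 192)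
    (δ * m * Real.log (q : ℝ)) (by positivity)
  obtain ⟨L, hL1, hLL⟩ : ∃ L : ℕ, 1 ≤ L ∧
      (126 * √((N₀ : ℝ) - 2 + 3) + 4 * √(Real.log 6 + ((N₀ : ℝ) - 2 + 2) * Real.log 27)) * √(L : ℝ) +
        Real.log 192 ≤ δ * m * Real.log (q : ℝ) * L :=
    ⟨max L₀ 1, le_max_right _ _, hL₀ _ (le_max_left _ _)⟩
  refine ⟨L, hL1, fun V hV => ?_⟩
  have hM1 : (1 : ℝ) ≤ L := by exact_mod_cast hL1
  have hN : (((L * N₀ : ℕ) : ℝ)) = ((N₀ : ℝ) - 2 + 2) * L := by push_cast; ring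
  rw [hN] at hV
  -- Step 1: the loss is at most `exp (δ m log q · L)`, hence `exp (N H) ≤ V exp (δ m log q · L)`
  have hloss := loss_le_exp hK hM1 hLL
  have hmain : Real.exp (((N₀ : ℝ) - 2 + 2) * L * H) ≤
      (V : ℝ) * Real.exp (δ * m * Real.log (q : ℝ) * L) :=
    calc Real.exp (((N₀ : ℝ) - 2 + 2) * L * H)
        ≤ (V : ℝ) * (((N₀ : ℝ) - 2 + 2) * L + 1) ^ 63 * 192 *
            Real.exp (4 * √(Real.log 6 + ((N₀ : ℝ) - 2 + 2) * L * Real.log 27)) := hV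
      _ = (V : ℝ) * ((((N₀ : ℝ) - 2 + 2) * L + 1) ^ 63 * 192 *
            Real.exp (4 * √(Real.log 6 + ((N₀ : ℝ) - 2 + 2) * L * Real.log 27))) := by
          rw [mul_assoc (V : ℝ), mul_assoc (V : ℝ)]
      _ ≤ (V : ℝ) * Real.exp (δ * m * Real.log (q : ℝ) * L) :=
          mul_le_mul_of_nonneg_left hloss (Nat.cast_nonneg V)
  have hkey : 1 ≤ (V : ℝ) *
      Real.exp (δ * m * Real.log (q : ℝ) * L - ((N₀ : ℝ) - 2 + 2) * L * H) := by
    rw [Real.exp_sub, mul_div_assoc', one_le_div (Real.exp_pos _)]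
    exact hmain
  -- Step 2: rewrite the real power `(q^{Lm})^(E+δ) = (q+2)^N · exp (δ m log q L − N H)`
  have hqm : (0 : ℝ) < (q : ℝ) ^ (L * m) := pow_pos hq0 _
  have hcast : ((q ^ (L * m) : ℕ) : ℝ) = (q : ℝ) ^ (L * m) := by push_cast; rfl
  have hq2 : (0 : ℝ) < (q : ℝ) + 2 := by positivity
  have hA : Real.exp (((N₀ : ℝ) - 2 + 2) * L * Real.log ((q : ℝ) + 2)) =
      ((q : ℝ) + 2) ^ (L * N₀) := by
    rw [← Real.exp_log (pow_pos hq2 (L * N₀)), Real.log_pow]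
    congr 1
    push_cast
    ring
  have halg : Real.log ((q : ℝ) ^ (L * m)) *
      ((Real.log ((q : ℝ) + 2) - H) / ((m : ℝ) / (N₀ : ℝ) * Real.log (q : ℝ)) + δ) =
      ((N₀ : ℝ) - 2 + 2) * L * Real.log ((q : ℝ) + 2) +
        (δ * m * Real.log (q : ℝ) * L - ((N₀ : ℝ) - 2 + 2) * L * H) := by
    rw [Real.log_pow]
    push_cast
    field_simp
    ring
  rw [hcast, Real.rpow_def_of_pos hqm, halg, Real.exp_add, hA]
  have hP : 0 ≤ ((q : ℝ) + 2) ^ (L * N₀) := by positivity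
  calc ((q : ℝ) + 2) ^ (L * N₀) = 1 * ((q : ℝ) + 2) ^ (L * N₀) := (one_mul _).symm
    _ ≤ ((V : ℝ) * Real.exp (δ * m * Real.log (q : ℝ) * L - ((N₀ : ℝ) - 2 + 2) * L * H)) *
          ((q : ℝ) + 2) ^ (L * N₀) := mul_le_mul_of_nonneg_right hkey hP
    _ = (V : ℝ) * (((q : ℝ) + 2) ^ (L * N₀) *
          Real.exp (δ * m * Real.log (q : ℝ) * L - ((N₀ : ℝ) - 2 + 2) * L * H)) := by ring

end Summit.MatrixMultiplication.MatrixMultiplication.Theorems.FarEdgeDescentLogRate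

end
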